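import Summits.QuantumFields.YangMills.Theorems.LuscherReductionTwistedTraceScalingBODefectCoreRate
import Summits.QuantumFields.YangMills.Theorems.TwistedTraceScaling.Negative.CoreWindowBand
import Summits.QuantumFields.YangMills.Theorems.TwistedTraceScaling.Negative.OneSiteGainWindow
import Summits.QuantumFields.YangMills.Theorems.LuscherReductionTwistedTraceScalingBTRatesAtoms
import Summits.QuantumFields.YangMills.Theorems.LuscherReductionTwistedTraceScalingBOCentralEventually
import HarnessLib

/-!
# (C4-SHELL, H2 «hOD below 1/6», part 3) THE CORE RATE OF THE (OD) RECORD IS POLYNOMIALLY SMALL AT EVERY TUBE EXPONENT: `b_core(β)² ≤ β^{-p}` eventually, every `p < min(2s, 2/5)`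
# (lane A of S-BASE, crux `TwistedTraceScaling` stmt-QuantumFields-20203, C4-SHELL; lead g23 card `pub/ym-fleet/ym-luscher-20007-p1/Lines-shell-gain.md` §3 DOMINATION / §4; cdisprove UPDATE 29 (A),(D); hand A `…-w1` g2)

The full core rate of ✓`…BODefectCoreRecord` / ✓`…BODefectCoreCurrency` (the `b_core` of ✓`…BODefectHOD.hOD_record`, there bounded only QUALITATIVELY: ✓`core_rate_small` = `b_core² = o(λ_b)` for
`1/6 < s < 1/4`) is
  `b_core = (max((1 − e^{−η})(1 − β^{-1/5}), e^{η}(1 + β^{-1/5}) − 1) + κ_P)·√(8/((1−κ_P)(1−β^{-1/5})²(1−κ_Q)))`,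
`η = coreEta + coreEps1 + coreEps2` at the windows `(δ, δu, σ) = (Dβ^{-s}, 14β^{-s}, β^{-2s})`, `κ_P = C_p(43β^{-s})²`, `κ_Q = C_q(43β^{-s})²`.  The thin shells of the C4-SHELL cut need its SIZE
at `s ≤ 1/6` (the lead's `ShellBricks.hdom` takes the explicit rate).  Here, for EVERY `0 < s ≤ 1/2`:
* `bcore_abstract_le` — the algebra: for `0 ≤ η ≤ 1`, `0 ≤ q, κ_P, κ_Q ≤ 1/2`, the displayed expression (NB: its first branch is `1 − e^{−η}·(1−q)`) is `≤ 12·(4η + q + κ_P)` (`1 − e^{−η}(1−q) ≤ η + q`, `e^{η} ≤ 1 + 2η` on `[0,1]`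
  (`Real.abs_exp_sub_one_le`), denominator `≥ 1/16`); `sq_sum_three_le` — `(4η + q + κ)² ≤ 3(16η² + q² + κ²)`;
* ★★ `core_rate_sq_le_powScale (0 < s ≤ 1/2) (p < 2s) (p < 2/5)` — `∀ᶠ β, b_core(β)² ≤ powScale p β`: `η ≤ C·K·ℓ⁶·β^{-s}` by cdisprove R54B ✓`Negative.R54B.windows_exponent_le` (band bound at
  `m = s ≤ 1/2`; NO `s > 1/6`), `β^{-2/5}` from the fixed central-quasimode rate, `κ_P² ≍ β^{-4s}`; comparison of polynomial scales ✓`Negative.R23.mul_powScale_le_eventually`,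
  ✓`tendsto_powScale_mul_btLog_pow`.
So below `1/6` the core rate is `β^{-s}·polylog` — NOT `o(λ_b)` — which is exactly what DOMINATION (`2b²/θ₀ ≤ t√t/80`, `t ≍ β^{-a}`, `3a/2 < 2s`) can afford (cdisprove R71 window).
HONEST FRAMING: exponent bookkeeping for a stub of a child of the CONDITIONAL route R2b1; C4-SHELL, the crux remain OPEN; not infinite volume, not a gap, not Clay.
-/

set_option autoImplicit false

noncomputable section

open MeasureTheory Filter Topology Real
open Literature.MathematicalPhysics.QuantumFieldTheory
open Literature.MathematicalPhysics.QuantumLattice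

namespace Summit.QuantumFields.YangMills.Theorems.FemtoTransferGap.TwoLattice.ConstTube

open Summit.QuantumFields.YangMills.Theorems.FemtoTransferGap
open Summit.QuantumFields.YangMills.Theorems.FemtoTransferGap.TwoLattice
open Summit.QuantumFields.YangMills.Theorems.TwistedTraceScaling.Negative

variable {L : ℕ} [NeZero L]

/-! ## §1 The algebra of the core rate -/

omit [NeZero L] in
/-- **The core-rate expression is at most `12(4η + q + κ_P)`** for `0 ≤ η ≤ 1`, `0 ≤ q, κ_P ≤ 1/2`, `κ_Q ≤ 1/2`. [folklore] -/
theorem bcore_abstract_le {η q κP κQ : ℝ} (hη0 : 0 ≤ η) (hη1 : η ≤ 1) (hq0 : 0 ≤ q) (hq : q ≤ 1 / 2)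
    (hκP0 : 0 ≤ κP) (hκP : κP ≤ 1 / 2) (hκQ : κQ ≤ 1 / 2) :
    (max (1 - Real.exp (-η) * (1 - q)) (Real.exp η * (1 + q) - 1) + κP) * Real.sqrt (8 / ((1 - κP) * (1 - q) ^ 2 * (1 - κQ))) ≤
      12 * (4 * η + q + κP) := by
  -- the two branches of the max (NB: the record expression is `1 − e^{−η}·(1 − q)`)
  have h1 : 1 - η ≤ Real.exp (-η) := by linarith [Real.add_one_le_exp (-η)]
  have he1 : Real.exp (-η) ≤ 1 := Real.exp_le_one_iff.mpr (by linarith)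
  have hA : 1 - Real.exp (-η) * (1 - q) ≤ 4 * η + q := by
    have : (1 - η) * (1 - q) ≤ Real.exp (-η) * (1 - q) := mul_le_mul_of_nonneg_right h1 (by linarith)
    nlinarith
  have h2 : Real.exp η ≤ 1 + 2 * η := by
    have h := Real.abs_exp_sub_one_le (x := η) (by rw [abs_of_nonneg hη0]; exact hη1)
    rw [abs_of_nonneg hη0] at h
    have := (abs_le.1 h).2
    linarith
  have hB : Real.exp η * (1 + q) - 1 ≤ 4 * η + q := by
    have : Real.exp η * (1 + q) ≤ (1 + 2 * η) * (1 + q) := mul_le_mul_of_nonneg_right h2 (by linarith)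
    nlinarith
  have hmax : max (1 - Real.exp (-η) * (1 - q)) (Real.exp η * (1 + q) - 1) ≤ 4 * η + q := max_le hA hB
  have hmax0 : 0 ≤ max (1 - Real.exp (-η) * (1 - q)) (Real.exp η * (1 + q) - 1) := by
    refine le_max_of_le_left ?_
    have : Real.exp (-η) * (1 - q) ≤ 1 * 1 := mul_le_mul he1 (by linarith) (by linarith) zero_le_one
    linarith
  -- the square root
  have hden : 1 / 16 ≤ (1 - κP) * (1 - q) ^ 2 * (1 - κQ) := by
    have a1 : 1 / 2 ≤ 1 - κP := by linarith
    have a2 : 1 / 4 ≤ (1 - q) ^ 2 := by nlinarith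
    have a3 : 1 / 2 ≤ 1 - κQ := by linarith
    calc (1 : ℝ) / 16 = 1 / 2 * (1 / 4) * (1 / 2) := by norm_num
      _ ≤ (1 - κP) * (1 - q) ^ 2 * (1 - κQ) := by
          apply mul_le_mul (mul_le_mul a1 a2 (by norm_num) (by linarith)) a3 (by norm_num)
          exact mul_nonneg (by linarith) (sq_nonneg _)
  have hsq : Real.sqrt (8 / ((1 - κP) * (1 - q) ^ 2 * (1 - κQ))) ≤ 12 := by
    rw [Real.sqrt_le_left (by norm_num)]
    rw [div_le_iff₀ (lt_of_lt_of_le (by norm_num) hden)]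
    nlinarith
  have hsq0 : 0 ≤ Real.sqrt (8 / ((1 - κP) * (1 - q) ^ 2 * (1 - κQ))) := Real.sqrt_nonneg _
  calc _ ≤ (4 * η + q + κP) * 12 := mul_le_mul (by linarith) hsq hsq0 (by linarith)
    _ = 12 * (4 * η + q + κP) := by ring

omit [NeZero L] in
/-- `(12(4η + q + κ))² ≤ 432·(16η² + q² + κ²)`. [folklore] -/
theorem sq_bcore_bound_le (η q κ : ℝ) : (12 * (4 * η + q + κ)) ^ 2 ≤ 432 * (16 * η ^ 2 + q ^ 2 + κ ^ 2) := by
  nlinarith [sq_nonneg (4 * η - q), sq_nonneg (4 * η - κ), sq_nonneg (q - κ)]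

/-! ## §2 ★★ The core rate squared is below every polynomial scale `β^{-p}`, `p < min(2s, 2/5)` -/

set_option maxHeartbeats 1600000 in
-- explicit record expressions.
/-- ★★ **`b_core(β)² ≤ powScale p β` eventually**, for `0 < s ≤ 1/2`, `D, C_p ≥ 0` (any `C_q`), every `p < 2s`, `p < 2/5`. [cite: Luscher1983, §3] -/
theorem core_rate_sq_le_powScale {s D Cp Cq : ℝ} (hs : 0 < s) (hs2 : s ≤ 1 / 2) (hD : 0 ≤ D) (hCp : 0 ≤ Cp)
    {p : ℝ} (hp : p < 2 * s) (hp5 : p < 2 / 5) :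
    ∀ᶠ β : ℝ in atTop, ((max (1 - Real.exp (-(coreEta L β (D * powScale s β) ((D * powScale s β) + (14 * powScale s β)) (9 * (L : ℝ) * (5 * (powScale (1 / 2) β * btLog β ^ 2)) + (powScale 1 β)) (min (1 / 40) (powScale (1 / 2) β * btLog β)) ((powScale 1 β) * Fintype.card (Site 3 L)) (powScale (2 * s) β) + coreEps1 L β (D * powScale s β) (9 * (L : ℝ) * (5 * (powScale (1 / 2) β * btLog β ^ 2)) + (powScale 1 β)) (min (1 / 40) (powScale (1 / 2) β * btLog β)) + coreEps2 L β (D * powScale s β) (9 * (L : ℝ) * (5 * (powScale (1 / 2) β * btLog β ^ 2)) + (powScale 1 β)) (min (1 / 40) (powScale (1 / 2) β * btLog β)) (powScale (2 * s) β))) * (1 - powScale (1 / 5) β)) (Real.exp (coreEta L β (D * powScale s β) ((D * powScale s β) + (14 * powScale s β)) (9 * (L : ℝ) * (5 * (powScale (1 / 2) β * btLog β ^ 2)) + (powScale 1 β)) (min (1 / 40) (powScale (1 / 2) β * btLog β)) ((powScale 1 β) * Fintype.card (Site 3 L)) (powScale (2 * s) β) + coreEps1 L β (D * powScale s β) (9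 * (L : ℝ) * (5 * (powScale (1 / 2) β * btLog β ^ 2)) + (powScale 1 β)) (min (1 / 40) (powScale (1 / 2) β * btLog β)) + coreEps2 L β (D * powScale s β) (9 * (L : ℝ) * (5 * (powScale (1 / 2) β * btLog β ^ 2)) + (powScale 1 β)) (min (1 / 40) (powScale (1 / 2) β * btLog β)) (powScale (2 * s) β)) * (1 + powScale (1 / 5) β) - 1) + (Cp * (43 * powScale s β) ^ 2)) * Real.sqrt (8 / ((1 - (Cp * (43 * powScale s β) ^ 2)) * (1 - powScale (1 / 5) β) ^ 2 * (1 - (Cq * (43 * powScale s β) ^ 2))))) ^ 2 ≤ powScale p β := by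
  -- the band bound on the exponent
  set CK : ℝ := (D + 14 + 1 + 45 * (L : ℝ) + 2) *
      (1614 * (Fintype.card (Edge 3 L) : ℝ) * (45 * (L : ℝ) + 1) ^ 2 + 216 * (Fintype.card (Site 3 L) : ℝ) +
        145005300 * (Fintype.card (Plaquette 3 L × Fin 3) : ℝ) + 2193291 * (Fintype.card (Plaquette 3 L) : ℝ) * (45 * (L : ℝ) + 1) ^ 2) with hCK
  have hCK0 : 0 ≤ CK := by rw [hCK]; positivity
  have hC0 : 0 < D + 14 + 1 + 45 * (L : ℝ) + 2 := by positivity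
  -- the eventual smallness facts
  have hCu : ∀ᶠ β : ℝ in atTop, (D + 14 + 1 + 45 * (L : ℝ) + 2) * (btLog β ^ 2 * powScale s β) ≤ 1 := by
    have h := (tendsto_powScale_mul_btLog_pow hs 2).const_mul (D + 14 + 1 + 45 * (L : ℝ) + 2)
    rw [mul_zero] at h
    filter_upwards [h.eventually (eventually_le_nhds one_pos)] with β hβ
    rw [mul_comm (btLog β ^ 2)]; exact hβ
  have hη1 : ∀ᶠ β : ℝ in atTop, CK * btLog β ^ 6 * powScale s β ≤ 1 := by
    have h := (tendsto_powScale_mul_btLog_pow hs 6).const_mul CK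
    rw [mul_zero] at h
    filter_upwards [h.eventually (eventually_le_nhds one_pos)] with β hβ
    calc CK * btLog β ^ 6 * powScale s β = CK * (powScale s β * btLog β ^ 6) := by ring
      _ ≤ 1 := hβ
  have hq : ∀ᶠ β : ℝ in atTop, powScale (1 / 5) β ≤ 1 / 2 :=
    (tendsto_powScale (σ := 1 / 5) (by norm_num)).eventually (eventually_le_nhds (by norm_num))
  have hκt : Tendsto (fun β : ℝ => (43 * powScale s β) ^ 2) atTop (𝓝 0) := by
    have h := ((tendsto_powScale hs).const_mul 43).pow 2
    rw [mul_zero, zero_pow two_ne_zero] at h; exact h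
  have hκP : ∀ᶠ β : ℝ in atTop, (Cp * (43 * powScale s β) ^ 2) ≤ 1 / 2 := by
    have h := hκt.const_mul Cp; rw [mul_zero] at h; exact h.eventually (eventually_le_nhds (by norm_num))
  have hκQ : ∀ᶠ β : ℝ in atTop, (Cq * (43 * powScale s β) ^ 2) ≤ 1 / 2 := by
    have h := hκt.const_mul Cq; rw [mul_zero] at h; exact h.eventually (eventually_le_nhds (by norm_num))
  -- the three polynomial comparisons, each against `powScale p β / 1296`
  have hsp : 0 < 2 * s - p := by linarith
  have hT1 : ∀ᶠ β : ℝ in atTop, 432 * 16 * (CK ^ 2 * (powScale (2 * s - p) β * btLog β ^ 12)) ≤ 1 / 3 := by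
    have h := (tendsto_powScale_mul_btLog_pow hsp 12).const_mul (432 * 16 * CK ^ 2)
    rw [mul_zero] at h
    filter_upwards [h.eventually (eventually_le_nhds (by norm_num : (0:ℝ) < 1 / 3))] with β hβ
    calc 432 * 16 * (CK ^ 2 * (powScale (2 * s - p) β * btLog β ^ 12)) = 432 * 16 * CK ^ 2 * (powScale (2 * s - p) β * btLog β ^ 12) := by ring
      _ ≤ 1 / 3 := hβ
  obtain ⟨β₂, hT2⟩ := R23.mul_powScale_le_eventually (a := 2 / 5) (b := p) hp5 432 (D := 1 / 3) (by norm_num)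
  obtain ⟨β₃, hT3⟩ := R23.mul_powScale_le_eventually (a := 4 * s) (b := p) (by linarith) (432 * (Cp ^ 2 * 43 ^ 4)) (D := 1 / 3) (by norm_num)
  filter_upwards [hCu, hη1, hq, hκP, hκQ, hT1, eventually_ge_atTop β₂, eventually_ge_atTop β₃, eventually_ge_atTop (1 : ℝ)]
    with β hCuβ hη1β hqβ hκPβ hκQβ hT1β hβ2 hβ3 hβ1
  have hβ0 : (0 : ℝ) ≤ β := by linarith
  -- the exponent
  have hδ0 : 0 ≤ D * powScale s β := mul_nonneg hD (powScale_pos _ _).le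
  have hδu0 : (0 : ℝ) ≤ 14 * powScale s β := mul_nonneg (by norm_num) (powScale_pos _ _).le
  have hσS : powScale (2 * s) β ≤ 1 * powScale s β ^ 2 := by rw [one_mul, R21.powScale_sq]
  have hηle := R54B.windows_exponent_le (L := L) (m := s) (D := D) (A := 14) (S := 1) hs2 hD (by norm_num) zero_le_one hβ1 hCuβ
    hδ0 le_rfl hδu0 le_rfl hσS
  have hT0 := R52.schedT_nonneg (L := L) β
  have hΓ0 : 0 ≤ powScale 1 β * Fintype.card (Site 3 L) := by have := powScale_pos 1 β; positivity
  have hη0 : 0 ≤ coreEta L β (D * powScale s β) ((D * powScale s β) + (14 * powScale s β)) (9 * (L : ℝ) * (5 * (powScale (1 / 2) β * btLog β ^ 2)) + (powScale 1 β)) (min (1 / 40) (powScale (1 / 2) β * btLog β)) ((powScale 1 β) * Fintype.card (Site 3 L)) (powScale (2 * s) β) + coreEps1 L β (D * powScale s β) (9 * (L : ℝ) * (5 * (powScale (1 / 2) β * btLog β ^ 2)) + (powScale 1 β)) (min (1 / 40) (powScale (1 / 2) β * btLog β)) + coreEps2 L β (D * powScale s β) (9 * (L : ℝ) * (5 * (powScale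 (1 / 2) β * btLog β ^ 2)) + (powScale 1 β)) (min (1 / 40) (powScale (1 / 2) β * btLog β)) (powScale (2 * s) β) :=
    add_nonneg (add_nonneg (coreEta_nonneg hβ0 hδ0 (add_nonneg hδ0 hδu0) hT0 hΓ0 (powScale_pos _ _).le) (coreEps1_nonneg hβ0 hδ0 hT0))
      (coreEps2_nonneg hβ0 hT0 (powScale_pos _ _).le)
  have hηCK : coreEta L β (D * powScale s β) ((D * powScale s β) + (14 * powScale s β)) (9 * (L : ℝ) * (5 * (powScale (1 / 2) β * btLog β ^ 2)) + (powScale 1 β)) (min (1 / 40) (powScale (1 / 2) β * btLog β)) ((powScale 1 β) * Fintype.card (Site 3 L)) (powScale (2 * s) β) + coreEps1 L β (D * powScale s β) (9 * (L : ℝ) * (5 * (powScale (1 / 2) β * btLog β ^ 2)) + (powScale 1 β)) (min (1 / 40) (powScale (1 / 2) β * btLog β)) + coreEps2 L β (D * powScale s β) (9 * (L : ℝ) * (5 * (powScale (1 / 2) β * btLog β ^ 2)) + (powScale 1 β)) (min (1 / 40) (powScale (1 / 2) β * btLog β)) (powScale (2 * s) β) ≤ CK * btLog β ^ 6 * powScale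 s β := by
    rw [hCK]; exact hηle
  have hη1' : coreEta L β (D * powScale s β) ((D * powScale s β) + (14 * powScale s β)) (9 * (L : ℝ) * (5 * (powScale (1 / 2) β * btLog β ^ 2)) + (powScale 1 β)) (min (1 / 40) (powScale (1 / 2) β * btLog β)) ((powScale 1 β) * Fintype.card (Site 3 L)) (powScale (2 * s) β) + coreEps1 L β (D * powScale s β) (9 * (L : ℝ) * (5 * (powScale (1 / 2) β * btLog β ^ 2)) + (powScale 1 β)) (min (1 / 40) (powScale (1 / 2) β * btLog β)) + coreEps2 L β (D * powScale s β) (9 * (L : ℝ) * (5 * (powScale (1 / 2) β * btLog β ^ 2)) + (powScale 1 β)) (min (1 / 40) (powScale (1 / 2) β * btLog β)) (powScale (2 * s) β) ≤ 1 := hηCK.trans hη1β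
  -- abstract bound
  have hq0 : 0 ≤ powScale (1 / 5) β := (powScale_pos _ _).le
  have hκP0 : 0 ≤ (Cp * (43 * powScale s β) ^ 2) := by positivity
  have hA := bcore_abstract_le hη0 hη1' hq0 hqβ hκP0 hκPβ hκQβ
  have hA0 : 0 ≤ ((max (1 - Real.exp (-(coreEta L β (D * powScale s β) ((D * powScale s β) + (14 * powScale s β)) (9 * (L : ℝ) * (5 * (powScale (1 / 2) β * btLog β ^ 2)) + (powScale 1 β)) (min (1 / 40) (powScale (1 / 2) β * btLog β)) ((powScale 1 β) * Fintype.card (Site 3 L)) (powScale (2 * s) β) + coreEps1 L β (D * powScale s β) (9 * (L : ℝ) * (5 * (powScale (1 / 2) β * btLog β ^ 2)) + (powScale 1 β)) (min (1 / 40) (powScale (1 / 2) β * btLog β)) + coreEps2 L β (D * powScale s β) (9 * (L : ℝ) * (5 * (powScale (1 / 2) β * btLog β ^ 2)) + (powScale 1 β)) (min (1 / 40) (powScale (1 / 2) β * btLog β)) (powScale (2 * s) β))) * (1 - powScale (1 / 5) β)) (Real.exp (coreEta L β (D * powScale s β) ((D * powScale s β) + (14 * powScale s β)) (9 * (L : ℝ)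 * (5 * (powScale (1 / 2) β * btLog β ^ 2)) + (powScale 1 β)) (min (1 / 40) (powScale (1 / 2) β * btLog β)) ((powScale 1 β) * Fintype.card (Site 3 L)) (powScale (2 * s) β) + coreEps1 L β (D * powScale s β) (9 * (L : ℝ) * (5 * (powScale (1 / 2) β * btLog β ^ 2)) + (powScale 1 β)) (min (1 / 40) (powScale (1 / 2) β * btLog β)) + coreEps2 L β (D * powScale s β) (9 * (L : ℝ) * (5 * (powScale (1 / 2) β * btLog β ^ 2)) + (powScale 1 β)) (min (1 / 40) (powScale (1 / 2) β * btLog β)) (powScale (2 * s) β)) * (1 + powScale (1 / 5) β) - 1) + (Cp * (43 * powScale s β) ^ 2)) * Real.sqrt (8 / ((1 - (Cp * (43 * powScale s β) ^ 2)) * (1 - powScale (1 / 5) β) ^ 2 * (1 - (Cq * (43 * powScale s β) ^ 2))))) := by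
    apply mul_nonneg _ (Real.sqrt_nonneg _)
    refine add_nonneg (le_max_of_le_left ?_) hκP0
    have he1 : Real.exp (-(coreEta L β (D * powScale s β) ((D * powScale s β) + (14 * powScale s β)) (9 * (L : ℝ) * (5 * (powScale (1 / 2) β * btLog β ^ 2)) + (powScale 1 β)) (min (1 / 40) (powScale (1 / 2) β * btLog β)) ((powScale 1 β) * Fintype.card (Site 3 L)) (powScale (2 * s) β) + coreEps1 L β (D * powScale s β) (9 * (L : ℝ) * (5 * (powScale (1 / 2) β * btLog β ^ 2)) + (powScale 1 β)) (min (1 / 40) (powScale (1 / 2) β * btLog β)) + coreEps2 L β (D * powScale s β) (9 * (L : ℝ) * (5 * (powScale (1 / 2) β * btLog β ^ 2)) + (powScale 1 β)) (min (1 / 40) (powScale (1 / 2) β * btLog β)) (powScale (2 * s) β))) ≤ 1 := Real.exp_le_one_iff.mpr (by linarith)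
    have : Real.exp (-(coreEta L β (D * powScale s β) ((D * powScale s β) + (14 * powScale s β)) (9 * (L : ℝ) * (5 * (powScale (1 / 2) β * btLog β ^ 2)) + (powScale 1 β)) (min (1 / 40) (powScale (1 / 2) β * btLog β)) ((powScale 1 β) * Fintype.card (Site 3 L)) (powScale (2 * s) β) + coreEps1 L β (D * powScale s β) (9 * (L : ℝ) * (5 * (powScale (1 / 2) β * btLog β ^ 2)) + (powScale 1 β)) (min (1 / 40) (powScale (1 / 2) β * btLog β)) + coreEps2 L β (D * powScale s β) (9 * (L : ℝ) * (5 * (powScale (1 / 2) β * btLog β ^ 2)) + (powScale 1 β)) (min (1 / 40) (powScale (1 / 2) β * btLog β)) (powScale (2 * s) β))) * (1 - powScale (1 / 5) β) ≤ 1 * 1 := mul_le_mul he1 (by linarith) (by linarith [hq0]) zero_le_one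
    linarith
  -- square and compare
  generalize hηdef : coreEta L β (D * powScale s β) ((D * powScale s β) + (14 * powScale s β)) (9 * (L : ℝ) * (5 * (powScale (1 / 2) β * btLog β ^ 2)) + (powScale 1 β)) (min (1 / 40) (powScale (1 / 2) β * btLog β)) ((powScale 1 β) * Fintype.card (Site 3 L)) (powScale (2 * s) β) + coreEps1 L β (D * powScale s β) (9 * (L : ℝ) * (5 * (powScale (1 / 2) β * btLog β ^ 2)) + (powScale 1 β)) (min (1 / 40) (powScale (1 / 2) β * btLog β)) + coreEps2 L β (D * powScale s β) (9 * (L : ℝ) * (5 * (powScale (1 / 2) β * btLog β ^ 2)) + (powScale 1 β)) (min (1 / 40) (powScale (1 / 2) β * btLog β)) (powScale (2 * s) β) = η at hη0 hηCK hη1' hA hA0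
  generalize hqdef : powScale (1 / 5) β = q at hq0 hqβ hA hA0
  generalize hκPdef : (Cp * (43 * powScale s β) ^ 2) = κP at hκP0 hκPβ hA hA0
  generalize hκQdef : (Cq * (43 * powScale s β) ^ 2) = κQ at hκQβ hA hA0
  have hsq : (((max (1 - Real.exp (-η) * (1 - q)) (Real.exp η * (1 + q) - 1) + κP) * Real.sqrt (8 / ((1 - κP) * (1 - q) ^ 2 * (1 - κQ))))) ^ 2 ≤
      432 * (16 * η ^ 2 + q ^ 2 + κP ^ 2) :=
    (pow_le_pow_left₀ hA0 hA 2).trans (sq_bcore_bound_le η q κP)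
  refine hsq.trans ?_
  -- `η² ≤ CK²·ℓ¹²·β^{-2s} = CK²·(β^{-p}·β^{-(2s-p)}·ℓ¹²)`
  have hη2 : η ^ 2 ≤ CK ^ 2 * (powScale (2 * s - p) β * btLog β ^ 12) * powScale p β := by
    have h1 : η ^ 2 ≤ (CK * btLog β ^ 6 * powScale s β) ^ 2 := pow_le_pow_left₀ hη0 hηCK 2
    have h2 : (CK * btLog β ^ 6 * powScale s β) ^ 2 = CK ^ 2 * (powScale (2 * s - p) β * btLog β ^ 12) * powScale p β := by
      have e1 : powScale s β ^ 2 = powScale (2 * s - p) β * powScale p β := by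
        rw [R21.powScale_sq, powScale_mul_powScale]; ring_nf
      calc (CK * btLog β ^ 6 * powScale s β) ^ 2 = CK ^ 2 * btLog β ^ 12 * powScale s β ^ 2 := by ring
        _ = _ := by rw [e1]; ring
    rw [← h2]; exact h1
  have hq2 : q ^ 2 = powScale (2 / 5) β := by rw [← hqdef, R21.powScale_sq]; norm_num
  have hκ2 : κP ^ 2 = Cp ^ 2 * 43 ^ 4 * powScale (4 * s) β := by
    rw [← hκPdef]
    have e2 : powScale s β ^ 2 = powScale (2 * s) β := R21.powScale_sq s β
    have e4 : powScale (2 * s) β ^ 2 = powScale (4 * s) β := by rw [R21.powScale_sq]; ring_nf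
    calc (Cp * (43 * powScale s β) ^ 2) ^ 2 = Cp ^ 2 * 43 ^ 4 * (powScale s β ^ 2) ^ 2 := by ring
      _ = Cp ^ 2 * 43 ^ 4 * powScale (4 * s) β := by rw [e2, e4]
  have hpp : 0 < powScale p β := powScale_pos _ _
  have t1 : 432 * (16 * η ^ 2) ≤ 1 / 3 * powScale p β := by
    calc 432 * (16 * η ^ 2) ≤ 432 * (16 * (CK ^ 2 * (powScale (2 * s - p) β * btLog β ^ 12) * powScale p β)) := by
          gcongr
      _ = (432 * 16 * (CK ^ 2 * (powScale (2 * s - p) β * btLog β ^ 12))) * powScale p β := by ring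
      _ ≤ 1 / 3 * powScale p β := mul_le_mul_of_nonneg_right hT1β hpp.le
  have t2 : 432 * q ^ 2 ≤ 1 / 3 * powScale p β := by rw [hq2]; exact hT2 β hβ2
  have t3 : 432 * κP ^ 2 ≤ 1 / 3 * powScale p β := by
    rw [hκ2]
    calc 432 * (Cp ^ 2 * 43 ^ 4 * powScale (4 * s) β) = 432 * (Cp ^ 2 * 43 ^ 4) * powScale (4 * s) β := by ring
      _ ≤ 1 / 3 * powScale p β := hT3 β hβ3
  linarith

end Summit.QuantumFields.YangMills.Theorems.FemtoTransferGap.TwoLattice.ConstTube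

end
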